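import Literature.AlgebraicGeometry.AbelianSchemes.WeilDivisorPullbackOfRosatiAtPoint
import Literature.AlgebraicGeometry.AbelianSchemes.AbelianSchemeOverRingAction
import Literature.AlgebraicGeometry.AbelianSchemes.AbelianSchemeOverRestrictPt
import Literature.AlgebraicGeometry.AbelianSchemes.SymplecticLiftOfIsogenyTower
import Literature.AlgebraicGeometry.Motives.AbelianVarietyWeilPairingIdealTorsionIsotropy
import HarnessLib

/-!
# `ē^Θ_n(A[𝔟](κ̄), A[𝔠](κ̄)) = 1` for `𝔠·𝔟̄ = (n)` on a geometric fibre of an abelian scheme with `𝒪`-action and Rosati rows `ι(b̄) ≫ λ = λ ≫ ι(b)^∨`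
# ([MumfordAV1970] §20, §23 p. 208 and Thm. 2; [MumfordFogartyKirwan1994] Def. 6.2–6.3; [Shimura1998] (18.4b))

Layer `Literature/AlgebraicGeometry/AbelianSchemes`, namespace `Literature.AlgebraicGeometry.AbelianSchemes.AbelianSchemeOver`.
THEOREMS ONLY (no definition, no named fact, no instance, no notation, no `sorry`).  Cell `hodgecm-mathlib` (D-0151), P6 «MOD programme»,
crux hLiu418 (`stmt-HodgeConjecture-24832`, `--supports`, count-neutral), line L3 ROOF road «DUAL-B̄» (LA3-plan RULING #3): the **ISOTROPY
ORGAN** of the non-Lagrangian quotient-dual engine (`K := A[𝔟]`, `K′ := λ_*A[𝔠]`, `𝔠 := n𝔟̄⁻¹`) in SCHEME costume — the `ē^Θ_n`-clause of the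
`h` binder of ★ `hiso_of_isLambdaOfAt_of_weilPairingLevel_eq_one_of_subgroup` (`AbelianSchemeQuotientPoincareIsotropyOfSubgroup`), token for token.
Composition of ★ `AbelianVariety.weilPairingLevel_eq_one_of_idealTorsion` (the abelian-variety head: ★ (DEC) `DivisibleTorsionIdealImage` +
an `ē`-adjunction hypothesis) with ★ `weilPairingLevel_map_fibreHom_eq_of_rosati` (`WeilDivisorPullbackOfRosatiAtPoint`: the adjunction
`ē^Θ_n(ι(b)_s P, Q) = ē^Θ_n(P, ι(j)_s Q)` from the Rosati row `ι(j) ≫ λ = λ ≫ ι(b)^∨` under ★ `IsLambdaOfAt`).  HC_CM is proved only modulo the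
2 remaining named inputs (hLiu418 24832, h413 24833) until rung 0 closes; nothing here is about HC.

THE MATHEMATICS.  `A/S` an abelian scheme with an action `ι : 𝒪 → End_S(A)` of a Dedekind domain (★ `RingAction`), a dual pair `(Â, 𝒫)`,
`λ : A → Â` with `λ̄ = Λ(𝒪(Θ))` at the field-valued point `s : Spec Ω → S`; the FIBRE ACTION `φ_s(r) := ι(r)_s` on `A_s(Ω)` (passed as a map
`φ` with its defining equation — the cell's «map as a variable» convention) is additive, multiplicative, unital, with `φ_s(n) = (·)^n` (§1, from
the ★ `RingAction` laws and the cartesian-monoidal base change `(Over.pullback s).map`, Mathlib `Functor.map_mul`); ASSUME every `φ_s(r)`,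
`r ≠ 0`, surjective (isogenies are onto on points over `Ω = Ω̄`) and, for ideals `𝔟`, `𝔟̄ ≠ 0`, `𝔠` with `𝔠·𝔟̄ = (n)`, that every nonzero
`j ∈ 𝔟̄` has a ROSATI PARTNER `b ∈ 𝔟`: `ι(j) ≫ λ = λ ≫ ι(b)^∨` with `ι(b)_s` dominant (for a CM action with `ι`-compatible `λ`: `j = b̄`,
[Shimura1998] (18.4b)).  THEN `ē^Θ_n(x, y) = 1` for all `x, y ∈ A_s[n](Ω)` with `ι(𝔟)_s x = 1`, `ι(𝔠)_s y = 1` (§2); in particular for the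
fibre values `x = κ(s)`, `y = σ(s)` of SECTIONS `κ, σ ∈ A(S)` killed by `𝔟`, `𝔠` (§3, ★ `map_fibreHom_restrictPt`) — [MumfordAV1970] §23
Thm. 2's isotropy hypothesis for the kernel pair `(A[𝔟], A[n𝔟̄⁻¹])`.

* §1 `fibreAction_mul`, `fibreAction_add`, `fibreAction_mul_eq_comp`, `fibreAction_one`, `fibreAction_natCast`, `fibreAction_restrictPt` — the laws of
  `φ_s`;
* §2 **`weilPairingLevel_eq_one_of_fibreAction_idealTorsion`** (points of `A_s`);
* §3 **`weilPairingLevel_eq_one_of_restrictPt_of_comp_i_eq_one`** (sections `κ`, `σ` with `κ ≫ ι(𝔟) = 1`, `σ ≫ ι(𝔠) = 1`, binders `↑x = κ(s)`,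
  `↑y = σ(s)` of the ★ `h` clause).

## References
* [MumfordAV1970] D. Mumford, *Abelian Varieties* (1970), §20 pp. 183–186, §23 p. 208 and Thm. 2 (p. 231).
* [MumfordFogartyKirwan1994] D. Mumford, J. Fogarty, F. Kirwan, *Geometric Invariant Theory*, Ch. 6 §2 Def. 6.2–6.3 (p. 120), Ch. 7 §1 Def. 7.1.
* [Shimura1998] G. Shimura, *Abelian Varieties with Complex Multiplication and Modular Functions* (1998), (18.4b) p. 126.
* [GortzWedhorn2020] U. Görtz, T. Wedhorn, *Algebraic Geometry I*, Section (4.7) (p. 135).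
-/

set_option autoImplicit false

noncomputable section

-- `(A.fibre s).toAbelianVariety.X = (Over.pullback s).obj A.X` and `(fibreHom f s).hom.hom.hom = (Over.pullback s).map f` hold by `rfl`.
set_option backward.isDefEq.respectTransparency false

universe u

open CategoryTheory CategoryTheory.Limits AlgebraicGeometry MonoidalCategory CartesianMonoidalCategory
open scoped MonObj CategoryTheory.Obj

namespace Literature.AlgebraicGeometry.AbelianSchemes

namespace AbelianSchemeOver

open Literature.AlgebraicGeometry.Motives Literature.AlgebraicGeometry.AbelianVarieties

variable {S : Scheme.{u}} {A : AbelianSchemeOver S} {O : Type*} [CommRing O] (act : A.RingAction O)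
  {Ω : Type u} [Field Ω] (s : Spec (.of Ω) ⟶ S)
  (φ : O → (A.fibre s).toAbelianVariety.Points Ω → (A.fibre s).toAbelianVariety.Points Ω)
  (hφ : ∀ r x, φ r x = haveI := act.isMonHom r; AlgPoints.map (fibreHom (act.i r) s).hom.hom.hom x)

/-! ### §1 The laws of the fibre action `φ_s(r) = ι(r)_s` on `A_s(Ω)` -/

include hφ in
/-- `φ_s(r) P = P ≫ (ι(r) ×_S s)` — the fibre action through the base-change functor. [cite: GortzWedhorn2020, Section (4.7) (p. 135)] -/
theorem fibreAction_eq_comp_map (r : O) (x : (A.fibre s).toAbelianVariety.Points Ω) :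
    φ r x = x ≫ (Over.pullback s).map (act.i r) := by
  rw [hφ]
  rfl

include hφ in
/-- `φ_s(r)` is multiplicative: `ι(r)_s` is a homomorphism of group schemes. [cite: MumfordFogartyKirwan1994, Ch. 6 §2 Definition 6.3 (p. 120)] -/
theorem fibreAction_mul (r : O) (x y : (A.fibre s).toAbelianVariety.Points Ω) : φ r (x * y) = φ r x * φ r y := by
  haveI := act.isMonHom r
  rw [hφ, hφ, hφ]
  exact map_mul (IsMonHom.monoidHom (fibreHom (act.i r) s).hom.hom.hom (specOver Ω Ω)) x y

include hφ in
/-- `φ_s(r + r′) = φ_s(r) · φ_s(r′)`: `ι(r + r′) = ι(r)·ι(r′)` in `Hom_S(A, A)` (★ `RingAction.i_add`) and base change is a homomorphism on hom-groups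
(Mathlib `Functor.map_mul`, `MonObj.comp_mul`). [cite: GortzWedhorn2020, Section (4.7) (p. 135)] -/
theorem fibreAction_add (r r' : O) (x : (A.fibre s).toAbelianVariety.Points Ω) : φ (r + r') x = φ r x * φ r' x := by
  rw [fibreAction_eq_comp_map act s φ hφ, fibreAction_eq_comp_map act s φ hφ, fibreAction_eq_comp_map act s φ hφ, act.i_add,
    Functor.map_mul, MonObj.comp_mul]

include hφ in
/-- `φ_s(r r′) = φ_s(r) ∘ φ_s(r′)`: `ι(r r′) = ι(r′) ≫ ι(r)` (★ `RingAction.i_mul`) and base change is a functor. [cite: GortzWedhorn2020, Section (4.7) (p. 135)] -/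
theorem fibreAction_mul_eq_comp (r r' : O) (x : (A.fibre s).toAbelianVariety.Points Ω) : φ (r * r') x = φ r (φ r' x) := by
  rw [fibreAction_eq_comp_map act s φ hφ, fibreAction_eq_comp_map act s φ hφ, fibreAction_eq_comp_map act s φ hφ, act.i_mul,
    Functor.map_comp, Category.assoc]

include hφ in
/-- `φ_s(1) = id` (★ `RingAction.i_one`). [cite: GortzWedhorn2020, Section (4.7) (p. 135)] -/
theorem fibreAction_one (x : (A.fibre s).toAbelianVariety.Points Ω) : φ 1 x = x := by
  rw [fibreAction_eq_comp_map act s φ hφ, act.i_one, CategoryTheory.Functor.map_id]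
  exact Category.comp_id _

include hφ in
/-- `φ_s(n) = (·)^n`: `ι(n) = ι(1)^n = 𝟙^n` in `Hom_S(A, A)` (★ `RingAction.i_nsmul`) and base change is a homomorphism on hom-groups.
[cite: MumfordAV1970, §6 Application 3 (Proposition p. 64)] [cite: GortzWedhorn2020, Section (4.7) (p. 135)] -/
theorem fibreAction_natCast (N : ℕ) (x : (A.fibre s).toAbelianVariety.Points Ω) : φ (N : O) x = x ^ N := by
  rw [fibreAction_eq_comp_map act s φ hφ, show (N : O) = N • (1 : O) from (nsmul_one N).symm, act.i_nsmul, act.i_one]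
  induction N with
  | zero => rw [pow_zero, pow_zero, Functor.map_one, MonObj.comp_one]
  | succ n ih =>
    rw [pow_succ, pow_succ, Functor.map_mul, MonObj.comp_mul, ih, CategoryTheory.Functor.map_id]
    congr 1

include hφ in
/-- `φ_s(r)(κ(s)) = (κ ≫ ι(r))(s)` for a section `κ ∈ A(S)` (★ `map_fibreHom_restrictPt`). [cite: MumfordFogartyKirwan1994, Ch. 7 §1 Definition 7.1 (p. 129)] -/
theorem fibreAction_restrictPt (r : O) (κ : A.Sections) : φ r (A.restrictPt s κ) = A.restrictPt s (κ ≫ act.i r) := by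
  haveI := act.isMonHom r
  rw [hφ]
  exact map_fibreHom_restrictPt s (act.i r) κ

/-! ### §2 Isotropy on `Ω`-points of the fibre -/

include hφ in
/-- **`ē^Θ_n(x, y) = 1` FOR `ι(𝔟)_s x = 1`, `ι(𝔠)_s y = 1`, `𝔠·𝔟̄ = (n)`, GIVEN ROSATI PARTNERS.**  `A/S` with `ι : 𝒪 → End_S(A)` (`𝒪` Dedekind), a dual pair
`(Â, 𝒫)`, `λ : A → Â` with `λ̄ = Λ(𝒪(Θ))` at `s` (★ `IsLambdaOfAt`), `[n]_{A_s}` dominant; `φ = φ_s` the fibre action with every `φ_s(r)`, `r ≠ 0`,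
surjective on `A_s(Ω)`; ideals `𝔟`, `𝔟̄ ≠ 0`, `𝔠` with `𝔠·𝔟̄ = (n)`; every nonzero `j ∈ 𝔟̄` has `b ∈ 𝔟` with `ι(b)_s` dominant and the Rosati row
`ι(j) ≫ λ = λ ≫ ι(b)^∨`.  Then `ē^Θ_n(x, y) = 1` for `x, y ∈ A_s[n](Ω)` killed by `ι(𝔟)_s`, `ι(𝔠)_s`.  (★ AV head
`weilPairingLevel_eq_one_of_idealTorsion` with the adjunction ★ `weilPairingLevel_map_fibreHom_eq_of_rosati`.)
[cite: MumfordAV1970, §23 (p. 208) and Thm. 2 (p. 231)] [cite: Shimura1998, (18.4b) (p. 126)] [cite: MumfordFogartyKirwan1994, Ch. 6 §2 Definition 6.2–6.3 (p. 120)] -/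
theorem weilPairingLevel_eq_one_of_fibreAction_idealTorsion [IsDedekindDomain O] (D : A.DualPair) (lam : A.X ⟶ D.hat.X)
    (hsurj : ∀ r : O, r ≠ 0 → Function.Surjective (φ r))
    {𝔟 𝔟' 𝔠 : Ideal O} (h𝔟'0 : 𝔟' ≠ ⊥) {N : ℕ} (h𝔠 : 𝔠 * 𝔟' = Ideal.span {(N : O)})
    (hros : ∀ j ∈ 𝔟', j ≠ 0 → ∃ b ∈ 𝔟,
      (haveI := act.isMonHom b; IsDominant (AbelianVariety.Hom.toSchemeHom (fibreHom (act.i b) s))) ∧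
      (haveI := act.isMonHom b; act.i j ≫ lam = lam ≫ DualPair.dualIsogenyOver (act.i b) D D))
    {Θ : CartierDivisor (A.fibre s).toAbelianVariety.X.left} (hΘ : A.IsLambdaOfAt s D lam Θ)
    [IsDominant (AbelianVariety.Hom.toSchemeHom ((N : ℤ) • 𝟙 (A.fibre s).toAbelianVariety))]
    (x y : (A.fibre s).toAbelianVariety.torsionPoints Ω N) (hx : ∀ b ∈ 𝔟, φ b x = 1) (hy : ∀ r ∈ 𝔠, φ r y = 1) :
    (A.fibre s).toAbelianVariety.weilPairingLevel Θ x y = 1 := by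
  refine AbelianVariety.weilPairingLevel_eq_one_of_idealTorsion φ (fibreAction_mul act s φ hφ) (fibreAction_add act s φ hφ)
    (fibreAction_mul_eq_comp act s φ hφ) (fibreAction_one act s φ hφ) hsurj (fibreAction_natCast act s φ hφ N) h𝔟'0 h𝔠 Θ
    (fun j hj hj0 => ?_) x y hx hy
  obtain ⟨b, hb𝔟, hdom, hrow⟩ := hros j hj hj0
  refine ⟨b, hb𝔟, fun P Q P' Q' hP hQ => ?_⟩
  haveI := act.isMonHom b
  haveI := act.isMonHom j
  haveI := hdom
  rw [hφ] at hP hQ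
  exact weilPairingLevel_map_fibreHom_eq_of_rosati D lam s hΘ (act.i b) (act.i j) hrow P Q P' Q' hP hQ

/-! ### §3 Isotropy for fibre values of sections (the `h` clause of the quotient-dual engine) -/

include hφ in
/-- **THE `ē^Θ_n`-CLAUSE OF THE QUOTIENT-DUAL ENGINE FOR `K = A[𝔟]`, `K₂ = A[𝔠]`, `𝔠·𝔟̄ = (n)`**: with the data and hypotheses of §2, for
SECTIONS `κ, σ ∈ A(S)` with `κ ≫ ι(b) = 1` (`b ∈ 𝔟`) and `σ ≫ ι(r) = 1` (`r ∈ 𝔠`), and `n`-torsion points `x, y` of `A_s` with `↑x = κ(s)`,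
`↑y = σ(s)`: `ē^Θ_n(x, y) = 1` — token for token the inner clause of the `h` binder of ★
`hiso_of_isLambdaOfAt_of_weilPairingLevel_eq_one_of_subgroup`. [cite: MumfordAV1970, §23 (p. 208) and Thm. 2 (p. 231)]
[cite: MumfordFogartyKirwan1994, Ch. 7 §1 Definition 7.1 (p. 129)] -/
theorem weilPairingLevel_eq_one_of_restrictPt_of_comp_i_eq_one [IsDedekindDomain O] (D : A.DualPair) (lam : A.X ⟶ D.hat.X)
    (hsurj : ∀ r : O, r ≠ 0 → Function.Surjective (φ r))
    {𝔟 𝔟' 𝔠 : Ideal O} (h𝔟'0 : 𝔟' ≠ ⊥) {N : ℕ} (h𝔠 : 𝔠 * 𝔟' = Ideal.span {(N : O)})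
    (hros : ∀ j ∈ 𝔟', j ≠ 0 → ∃ b ∈ 𝔟,
      (haveI := act.isMonHom b; IsDominant (AbelianVariety.Hom.toSchemeHom (fibreHom (act.i b) s))) ∧
      (haveI := act.isMonHom b; act.i j ≫ lam = lam ≫ DualPair.dualIsogenyOver (act.i b) D D))
    {Θ : CartierDivisor (A.fibre s).toAbelianVariety.X.left} (hΘ : A.IsLambdaOfAt s D lam Θ)
    [IsDominant (AbelianVariety.Hom.toSchemeHom ((N : ℤ) • 𝟙 (A.fibre s).toAbelianVariety))]
    (κ σ : A.Sections) (hκ : ∀ b ∈ 𝔟, κ ≫ act.i b = 1) (hσ : ∀ r ∈ 𝔠, σ ≫ act.i r = 1)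
    (x y : (A.fibre s).toAbelianVariety.torsionPoints Ω N)
    (hx : (x : (A.fibre s).toAbelianVariety.Points Ω) = A.restrictPt s κ)
    (hy : (y : (A.fibre s).toAbelianVariety.Points Ω) = A.restrictPt s σ) :
    (A.fibre s).toAbelianVariety.weilPairingLevel Θ x y = 1 :=
  weilPairingLevel_eq_one_of_fibreAction_idealTorsion act s φ hφ D lam hsurj h𝔟'0 h𝔠 hros hΘ x y
    (fun b hb => by rw [hx, fibreAction_restrictPt act s φ hφ, hκ b hb, restrictPt_one])
    (fun r hr => by rw [hy, fibreAction_restrictPt act s φ hφ, hσ r hr, restrictPt_one])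

end AbelianSchemeOver

end Literature.AlgebraicGeometry.AbelianSchemes

end
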